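import Summits.QuantumAdvantage.QuantumAdvantage.Theses.Refuters
import Literature.Computability.Complexity.BPClosureProofs
import Literature.Computability.Complexity.UnaryArithMachines
import Literature.Computability.Cryptography.ShorAssemblyLeavesProofs
import Literature.Computability.Cryptography.DLogHalf
import Literature.Computability.MetaComplexity.ConstructiveSeparationsNP

/-!
# Crux-strategist sketch for `Refuters.RefThesis` (stmt-QuantumAdvantage-2034), RESTATED re-audit

Typed objects behind STRATEGY-CENSUS.md: the candidate decompositions D1–D8 of
`RefThesis` (X_B, constructive quantum advantage), their assemblies (all proved, trivial seams),
the "at-least-summit" witnesses that make criterion (c) fail IN SUBSTANCE for the hypothesis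
pieces, and finding V1: the pinning engine of the route (items RefPinnedDichotomy 2036,
RefPinnedAdvantage 2043) is VACUOUS as typed — its two hypotheses are jointly unsatisfiable,
because BPP's polynomial slack absorbs constant factors in the exponent
(`kPad a k L ≤ₚ padLang a L` by re-padding, `preimage_mem_BPP`). Everything here is sorry-free;
the single routine machine fact V1 needs (`RepadFP`: the re-padding map is in FP) is an explicit
hypothesis, as are the two closure facts of the tally engine.
-/

namespace Summit.QuantumAdvantage.QuantumAdvantage.Cruxes.RefThesis.Strategist

open Literature.Computability.Complexity Literature.Computability.Cryptography
open Literature.Computability.MetaComplexity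
open Summit.QuantumAdvantage.QuantumAdvantage.Theses.Refuters
open _root_.Computability Filter

/-! ## 0. The crux in the tree's CJSW vocabulary (ConstructiveSeparations.lean) -/

theorem refThesis_iff :
    RefThesis ↔ ∃ L ∈ Literature.Computability.Cryptography.BQP,
      HasBPPConstructiveSeparation L Literature.Computability.Complexity.BPP := Iff.rfl

/-- X_B ⇒ S (the route's `closes`, library form). -/
theorem refThesis_atLeastSummit : RefThesis → QuantumAdvantage := by
  rintro ⟨L, hL, h⟩
  exact ⟨L, hL, not_mem_of_hasBPPConstructiveSeparation h⟩

/-! ## D1 — PINNING (generic exponential profile): pieces, assembly, and finding V1 -/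

/-- Hypothesis piece of D1 (= antecedent of item RefPinnedAdvantage, stmt-…-2043). -/
def PinnedWitness : Prop :=
  ∃ L ∈ Literature.Computability.Cryptography.BQP, ∃ a k : ℕ, 1 ≤ a ∧ 1 ≤ k ∧
    padLang a L ∈ Literature.Computability.Complexity.BPP ∧
    {w : List Bool | ∃ x ∈ L, w = List.replicate (2 ^ ((x.length ^ a + k - 1) / k)) true ++
      false :: x} ∉ Literature.Computability.Complexity.BPP

/-- D1 assembly (b): three pieces, term-mode seam. -/
theorem d1_assembly : PinnedWitness → RefPinnedDichotomy → RefPadAllMemBQP → RefThesis := by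
  rintro ⟨L, hL, a, k, ha, hk, hup, hlow⟩ hD hP
  exact ⟨_, hP L hL, hD L a k ha hk hup hlow⟩

/-- The `k`-padded language of the pinning engine. -/
def kPad (a k : ℕ) (L : Language Bool) : Language Bool :=
  {w : List Bool | ∃ x ∈ L, w = List.replicate (2 ^ ((x.length ^ a + k - 1) / k)) true ++
    false :: x}

/-- The re-padding reduction `kPad a k L → padLang a L`: `1^t 0 x ↦ 1^{2^{|x|^a}} 0 x` when
`t = 2^{⌈|x|^a/k⌉}`, everything else to the non-member `[]`. Output length ≤ |w|^k + |w|. -/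
def repad (a k : ℕ) (w : List Bool) : List Bool :=
  if false ∈ w ∧ (splitOnes w).1 = 2 ^ (((splitOnes w).2.length ^ a + k - 1) / k)
  then expPad a (splitOnes w).2 else []

theorem splitOnes_replicate_append (t : ℕ) (x : List Bool) :
    splitOnes (List.replicate t true ++ false :: x) = (t, x) := by
  induction t with
  | zero => rfl
  | succ t ih => simp [List.replicate_succ, splitOnes, ih]

theorem eq_replicate_append_of_false_mem :
    ∀ w : List Bool, false ∈ w →
      w = List.replicate (splitOnes w).1 true ++ false :: (splitOnes w).2
  | [], h => by simp at h
  | true :: u, h => by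
      have hu : false ∈ u := by simpa using h
      have ih := eq_replicate_append_of_false_mem u hu
      simp only [splitOnes]
      rw [List.replicate_succ, List.cons_append]
      exact congrArg (List.cons true) ih
  | false :: u, _ => by simp [splitOnes]

theorem nil_not_mem_padLang (a : ℕ) (L : Language Bool) : ([] : List Bool) ∉ padLang a L := by
  rw [mem_padLang_iff]
  rintro ⟨x, -, hx⟩
  have h := congrArg List.length hx
  rw [length_expPad, List.length_nil] at h
  exact Nat.succ_ne_zero _ h

/-- `kPad a k L` is the preimage of `padLang a L` under the re-padding map. -/
theorem kPad_eq_preimage (a k : ℕ) (L : Language Bool) :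
    kPad a k L = repad a k ⁻¹' padLang a L := by
  ext w
  change w ∈ kPad a k L ↔ repad a k w ∈ padLang a L
  constructor
  · rintro ⟨x, hx, rfl⟩
    have hs := splitOnes_replicate_append (2 ^ ((x.length ^ a + k - 1) / k)) x
    have hf : false ∈ List.replicate (2 ^ ((x.length ^ a + k - 1) / k)) true ++ false :: x := by
      simp
    have hc : false ∈ List.replicate (2 ^ ((x.length ^ a + k - 1) / k)) true ++ false :: x ∧
        (splitOnes (List.replicate (2 ^ ((x.length ^ a + k - 1) / k)) true ++ false :: x)).1 =
          2 ^ (((splitOnes (List.replicate (2 ^ ((x.length ^ a + k - 1) / k)) true ++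
            false :: x)).2.length ^ a + k - 1) / k) := ⟨hf, by rw [hs]⟩
    rw [repad, if_pos hc, hs]
    exact expPad_mem_padLang_iff.mpr hx
  · intro hw
    unfold repad at hw
    split_ifs at hw with hc
    · obtain ⟨hf, ht⟩ := hc
      refine ⟨(splitOnes w).2, expPad_mem_padLang_iff.mp hw, ?_⟩
      conv_lhs => rw [eq_replicate_append_of_false_mem w hf]
      rw [ht]
    · exact absurd hw (nil_not_mem_padLang a L)

/-- The ONE routine machine fact V1 consumes: the re-padding map is polynomial time (guard =
unary parse + `ExpPad.prog`-style arithmetic; output `expPad a x` has length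
`2^{|x|^a}+|x|+1 ≤ (2^{⌈|x|^a/k⌉})^k + |w| ≤ |w|^k + |w|` and `ExpPad.prog a` runs in
`C·2^{|x|^a}+C ≤ C|w|^k + C` steps, `exists_timeComputable_expPad`). Not proved here (prover /
disprover task); kept as an explicit hypothesis so this file is sorry-free. -/
def RepadFP : Prop := ∀ a k : ℕ, 1 ≤ a → 1 ≤ k → repad a k ∈ FP

theorem kPad_mem_BPP (a k : ℕ) {L : Language Bool} (hFP : repad a k ∈ FP)
    (hup : padLang a L ∈ Literature.Computability.Complexity.BPP) :
    kPad a k L ∈ Literature.Computability.Complexity.BPP := by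
  rw [kPad_eq_preimage]; exact preimage_mem_BPP hup hFP

/-- **V1.** The pinning window is empty: `PinnedWitness` is false. -/
theorem not_pinnedWitness (hFP : RepadFP) : ¬ PinnedWitness := by
  rintro ⟨L, -, a, k, ha, hk, hup, hlow⟩
  exact hlow (kPad_mem_BPP a k (hFP a k ha hk) hup)

/-- **V1, item 2036.** `RefPinnedDichotomy` holds VACUOUSLY (its hypotheses contradict). -/
theorem refPinnedDichotomy_vacuous (hFP : RepadFP) : RefPinnedDichotomy := by
  intro L a k ha hk hup hlow
  exact absurd (kPad_mem_BPP a k (hFP a k ha hk) hup) hlow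

/-- **V1, item 2043.** `RefPinnedAdvantage` holds VACUOUSLY (false antecedent). -/
theorem refPinnedAdvantage_vacuous (hFP : RepadFP) : RefPinnedAdvantage :=
  fun h => absurd h (not_pinnedWitness hFP)

/-! ## D3 — PLANTING: pieces, assembly, and why (c) fails in substance -/

/-- Hypothesis piece of D3 (= antecedent of item RefPlantedRefuter, stmt-…-2041, with `∃ L ∈ BQP`). -/
def PlantedWitness : Prop :=
  ∃ L ∈ Literature.Computability.Cryptography.BQP, ∃ S : RandAlg ℕ (List Bool × Bool),
    S.IsPolyTime unaryEncodeNat (fun p : List Bool × Bool => boolPair p.1 (encodeBool p.2)) ∧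
    (∃ q : Polynomial ℕ, ∀ n, S.coinLen n = q.eval n) ∧
    (∀ n, S.pr unaryEncodeNat n {p | p.1.length = n ∧ (p.2 = true ↔ p.1 ∈ L)} = 1) ∧
    ∀ L'' ∈ Literature.Computability.Complexity.BPP, ∃ c : ℕ, ∃ᶠ n : ℕ in Filter.atTop,
      (1 : ℝ) / ((n : ℝ) ^ c + 1) ≤ S.pr unaryEncodeNat n {p | p.1 ∈ L ↔ p.1 ∉ L''}

theorem d3_assembly : PlantedWitness → RefPlantedRefuter → RefThesis := by
  rintro ⟨L, hL, S, hS, hq, hans, hdis⟩ hP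
  exact ⟨L, hL, hP L S hS hq hans hdis⟩

/-- (c) fails in substance for D3: the hypothesis piece gives the summit in a few lines
(same argument as the route's `closes`: against `L'' := L` the disagreement event is empty). -/
theorem plantedWitness_atLeastSummit : PlantedWitness → QuantumAdvantage := by
  rintro ⟨L, hL, S, -, -, -, hdis⟩
  refine ⟨L, hL, fun hLBPP => ?_⟩
  obtain ⟨c, hc⟩ := hdis L hLBPP
  obtain ⟨n, hn⟩ := hc.exists
  have hempty : {p : List Bool × Bool | p.1 ∈ L ↔ p.1 ∉ L} = ∅ := by
    ext p
    simp only [Set.mem_setOf_eq, Set.mem_empty_iff_false, iff_false]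
    exact iff_not_self
  have h0 : S.pr unaryEncodeNat n {p : List Bool × Bool | p.1 ∈ L ↔ p.1 ∉ L} = 0 := by
    rw [hempty]; simp [RandAlg.pr]
  rw [h0] at hn
  have hpos : (0 : ℝ) < 1 / ((n : ℝ) ^ c + 1) := by positivity
  linarith

/-! ## D2 — FACTORING (Shor's hypothesis): pieces and assembly -/

/-- Hypothesis piece of D2 (= route Shor's `ShorThesis`). -/
def FactNotInBPP : Prop :=
  Literature.Computability.QuantumComplexity.FACT ∉ Literature.Computability.Complexity.BPP

/-- D2 assembly: the seam invokes Shor's theorem `FACT_mem_BQP_holds` (proved in Literature). -/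
theorem d2_assembly : FactNotInBPP → RefFactConstructive → RefThesis :=
  fun h1 h2 => ⟨_, FACT_mem_BQP_holds, h2 h1⟩

/-- (c) in print / in tree: the hypothesis piece is at-least-summit by a LANDED theorem
(route Shor's `closes`; here re-derived in one line from `FACT_mem_BQP_holds`). -/
theorem factNotInBPP_atLeastSummit : FactNotInBPP → QuantumAdvantage :=
  fun h => ⟨_, FACT_mem_BQP_holds, h⟩

/-! ## D6 — DISCRETE LOGARITHM (Blum–Micali half predicate): pieces and assembly -/

def DlogHalfNotInBPP : Prop := DLOGHalf ∉ Literature.Computability.Complexity.BPP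

/-- Known in print (Shor 1997 §6; tree: `isQSolvable_dlog_holds` is the search form), not yet
a tree theorem in this decision form. -/
def DlogHalfMemBQP : Prop := DLOGHalf ∈ Literature.Computability.Cryptography.BQP

/-- "Is the hardness of DLOG constructive?" — the DLOG analogue of item RefFactConstructive;
random self-reducibility (Blum–Micali) removes the pinpointing obstruction, leaving only the
findability of bad prime/generator pairs. -/
def DlogConstructive : Prop :=
  DLOGHalf ∉ Literature.Computability.Complexity.BPP →
    HasBPPConstructiveSeparation DLOGHalf Literature.Computability.Complexity.BPP

theorem d6_assembly : DlogHalfNotInBPP → DlogHalfMemBQP → DlogConstructive → RefThesis :=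
  fun h1 h2 h3 => ⟨_, h2, h3 h1⟩

/-! ## D4 — AUTOMATIC CONSTRUCTIVITY: the summit itself is a piece ((c) fails flatly) -/

theorem d4_assembly : QuantumAdvantage → RefAutoConstructive → RefThesis := fun h hA => hA h

/-! ## D8 — TALLY / EXPONENTIAL-TIME ADVANTAGE: pieces, assembly, the engine, (c) -/

def IsTally (L : Language Bool) : Prop := ∀ x ∈ L, ∀ b ∈ x, b = true

/-- Hypothesis piece of D8: a TALLY language separates BQP from BPP (⟺ BQE ≠ BPE by
Book-style translation; strictly stronger than S in print, converse open). -/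
def TallyQuantumAdvantage : Prop :=
  ∃ L ∈ Literature.Computability.Cryptography.BQP,
    L ∉ Literature.Computability.Complexity.BPP ∧ IsTally L

/-- The tally engine: a tally language outside BPP is BPP-constructively separated from BPP
(the refuter prints `1ⁿ`). -/
def TallyEngine : Prop :=
  ∀ L : Language Bool, IsTally L → L ∉ Literature.Computability.Complexity.BPP →
    HasBPPConstructiveSeparation L Literature.Computability.Complexity.BPP

theorem d8_assembly : TallyQuantumAdvantage → TallyEngine → RefThesis :=
  fun ⟨L, hL, hBPP, hT⟩ hE => ⟨L, hL, hE L hT hBPP⟩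

/-- (c) fails flatly for D8's hypothesis piece (drop the conjunct). -/
theorem tallyQuantumAdvantage_atLeastSummit : TallyQuantumAdvantage → QuantumAdvantage :=
  fun ⟨L, hL, hBPP, _⟩ => ⟨L, hL, hBPP⟩

/-- **The tally engine is provable now**, modulo two routine closure facts (BPP ∩ the tally set,
and the identity on unary inputs as a `PolyTimeComputable` map `ℕ → List Bool`): against
`L'' ∈ BPP` the coin-free refuter `n ↦ 1ⁿ` succeeds at every length where `L''` errs on a tally
string, and there are infinitely many (`frequently_exists_errs_of_not_mem_BPP` applied to
`L'' ∩ Tally`). -/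
theorem tallyEngine_of
    (hInter : ∀ L'' ∈ Literature.Computability.Complexity.BPP,
      {x : List Bool | x ∈ L'' ∧ ∀ b ∈ x, b = true} ∈ Literature.Computability.Complexity.BPP)
    (hId : PolyTimeComputable unaryEncodeNat (id : List Bool → List Bool)
      (fun n : ℕ => List.replicate n true)) :
    TallyEngine := by
  intro L hT hL L'' hL''
  refine ⟨RandAlg.ofDet (fun n : ℕ => List.replicate n true), RandAlg.IsPolyTime.ofDet_holds hId,
    ⟨0, fun n => by simp [RandAlg.ofDet]⟩, ?_⟩
  have hfreq := frequently_exists_errs_of_not_mem_BPP hL (hInter L'' hL'')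
  refine hfreq.mono fun n hn => ?_
  obtain ⟨x, hxn, hx⟩ := hn
  classical
  have hxt : ∀ b ∈ x, b = true := by
    by_contra hnt
    have hxL : x ∉ L := fun h => hnt (hT x h)
    have hmem : x ∈ {y : List Bool | y ∈ L'' ∧ ∀ b ∈ y, b = true} := by
      by_contra h'
      exact hxL (hx.mpr h')
    exact hnt hmem.2
  have hxr : x = List.replicate n true := by
    subst hxn
    exact List.eq_replicate_iff.mpr ⟨rfl, hxt⟩
  rw [RandAlg.pr_ofDet, if_pos]
  · norm_num
  · refine ⟨by simp, ?_⟩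
    rw [← hxr]
    constructor
    · intro hxL hxL''
      exact (hx.mp hxL) ⟨hxL'', hxt⟩
    · intro hxL''
      exact hx.mpr fun h => hxL'' h.1

/-- Negation side: ¬X_B forces every TALLY language of BQP into BPP (contrapositive of D8). -/
theorem tally_collapse_of_not_refThesis (hE : TallyEngine) (h : ¬ RefThesis) :
    ∀ L ∈ Literature.Computability.Cryptography.BQP, IsTally L →
      L ∈ Literature.Computability.Complexity.BPP := by
  intro L hL hT
  by_contra hBPP
  exact h ⟨L, hL, hE L hT hBPP⟩

end Summit.QuantumAdvantage.QuantumAdvantage.Cruxes.RefThesis.Strategist
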